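import Literature.NumberTheory.EllipticCurves.AlgebraicModularParametrizationWithShift
import Literature.NumberTheory.EllipticCurves.TwoTorsionGaloisActionProofs
import HarnessLib

/-!
# Crux C1 `MainConjectureTransportAlignedAtTwo` (stmt-BirchSwinnertonDyer-22296), line `birth`, plan «deltapos-galois» step (G2, the point link):
# A `2`-TORSION POINT OVER `ℚ̄` WHOSE ABSCISSA IS `℘(z) − b₂/12` GOES TO `u_W(z)` IN `W(ℂ)` (lead att-p1 g10; `--supports 22296`)

THEOREMS ONLY (no `def`, no `sorry`, no named fact). BSD is not proved by this; C1 is not closed by this.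

Context (`Cruxes/MainConjectureTransportAlignedAtTwo/Lines/birth-deltapos-galois-plan.md`, file (G2)). The Galois side speaks about the points
`T W i ∈ geomTorsion W 2` over `ℚ̄` (letters `xT W i`; `…DeltaPosGaloisPlane` §3: THE equivariant isomorphism matches the letters of each embedding), the
analytic side about `u_W(w) = D.uniformize w`, `w = iΩ₀'/2` (`…HalfPeriodOrdering`, `…DeltaPosLeastRoot`: its abscissa `℘(w) − b₂/12` is the least one;
`…DeltaPosFunctional`: the plus functional mod 2 is the pairing with it). This file links the two through an embedding `ι : ℚ̄ → ℂ`
(`WeierstrassCurve.geomPointsToComplex W ι`, the map of the carrier `ModularJacobianGaloisData`):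
* `two_smul_uniformize_eq_zero` — `u_W(z)` is `2`-torsion for a half-period `z`;
* `eq_of_X_eq_of_two_torsion` — two non-zero points of `W(ℂ)` with the same abscissa, one of them `2`-torsion, are equal;
* **`geomPointsToComplex_eq_uniformize_of_xco`** — for `P ∈ W(ℚ̄)`, `P ≠ O`, and a half-period `z` with `ι(x(P)) = ℘(z) − b₂/12`:
  `geomPointsToComplex ι P = D.uniformize z`. With `…DeltaPosLeastRoot.leastRoot_iff` (least root `= 4·re ℘(w) − b₂/3`) this turns «`σ(e)` is the
  least real root» (`AlignedAtInfinity`) into «the letter of `σ` goes to `T* = u_W(w)`».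

References: Silverman AEC III.2.3 (points with equal abscissa), VI.3.6 (uniformisation) [SilvermanAEC2009].
-/

noncomputable section

-- justification: the `Summit.BirchSwinnertonDyer.BirchSwinnertonDyer.…` path repeats a component (route-file convention)
set_option linter.dupNamespace false
set_option autoImplicit false

open scoped Classical
open Complex WeierstrassCurve
open Literature.NumberTheory.EllipticCurves Literature.NumberTheory.EllipticCurves.ModularForms
open Literature.NumberTheory.EllipticCurves.DokchitserDokchitser2012

namespace Summit.BirchSwinnertonDyer.BirchSwinnertonDyer.Theorems.AlignedTransportAtTwoDeltaPosPointLink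

variable {W : WeierstrassCurve ℚ} {N : ℕ} [NeZero N] (D : ModularParametrizationData W N)

/-- **`u_W(z)` is `2`-torsion for a half-period `z`** (`2z ∈ Λ_E = ker u_W`). [cite: SilvermanAEC2009, VI.3.6] -/
theorem two_smul_uniformize_eq_zero {z : ℂ} (h2z : 2 * z ∈ D.L.lattice) : (2 : ℕ) • D.uniformize z = 0 := by
  rw [← map_nsmul, nsmul_eq_mul, Nat.cast_ofNat]
  have : 2 * z ∈ D.uniformize.ker := by
    rw [← SetLike.mem_coe, D.ker_uniformize]; exact h2z
  exact this

/-- **Two non-zero points of `W(ℂ)` with the same abscissa, the second one `2`-torsion, are equal** (they are `±` each other and `−Q = Q`).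
[cite: SilvermanAEC2009, III.2.3] -/
theorem eq_of_X_eq_of_two_torsion {x₁ y₁ x₂ y₂ : ℂ} {h₁ : (W.baseChange ℂ).toAffine.Nonsingular x₁ y₁}
    {h₂ : (W.baseChange ℂ).toAffine.Nonsingular x₂ y₂}
    (hQ : (2 : ℕ) • (Affine.Point.some x₂ y₂ h₂ : (W.baseChange ℂ).toAffine.Point) = 0) (hx : x₁ = x₂) :
    (Affine.Point.some x₁ y₁ h₁ : (W.baseChange ℂ).toAffine.Point) = Affine.Point.some x₂ y₂ h₂ := by
  have hneg : -(Affine.Point.some x₂ y₂ h₂ : (W.baseChange ℂ).toAffine.Point) = Affine.Point.some x₂ y₂ h₂ := by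
    rw [neg_eq_iff_add_eq_zero, ← two_nsmul]; exact hQ
  rcases (Affine.Point.X_eq_iff (h₁ := h₁) (h₂ := h₂)).mp hx with h | h
  · exact h
  · rw [hneg] at h; exact h

/-- **The point link.** For `P ∈ W(ℚ̄)` non-zero and a half-period `z` of the Néron lattice (`z ∉ Λ_E`, `2z ∈ Λ_E`) with
`ι(x(P)) = ℘(z) − b₂/12`: the complex point of `P` is the uniformised half-period, `geomPointsToComplex ι P = D.uniformize z`.
[cite: SilvermanAEC2009, VI.3.6 and III.2.3] -/
theorem geomPointsToComplex_eq_uniformize_of_xco (ι : AlgebraicClosure ℚ →+* ℂ) {P : W.geomPoints} (hP : P ≠ 0)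
    {z : ℂ} (hz : z ∉ D.L.lattice) (h2z : 2 * z ∈ D.L.lattice)
    (hx : ι (xco W P) = D.L.weierstrassP z - (W.baseChange ℂ).b₂ / 12) :
    W.geomPointsToComplex ι P = D.uniformize z := by
  obtain ⟨h, huz⟩ := D.uniformize_spec z hz
  have h2 : (2 : ℕ) • D.uniformize z = 0 := two_smul_uniformize_eq_zero D h2z
  rw [huz] at h2 ⊢
  -- `P = (x, y)` over `ℚ̄`, mapped coordinatewise by `ι`
  change (W.baseChange (AlgebraicClosure ℚ)).toAffine.Point at P
  rcases P with _ | ⟨x, y, hxy⟩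
  · exact absurd rfl hP
  · rw [WeierstrassCurve.geomPointsToComplex_apply]
    change Affine.Point.map ι.toRatAlgHom (Affine.Point.some x y hxy) = _
    rw [Affine.Point.map_some]
    refine eq_of_X_eq_of_two_torsion (hQ := h2) ?_
    change ι.toRatAlgHom x = _
    rw [← hx]
    rfl

end Summit.BirchSwinnertonDyer.BirchSwinnertonDyer.Theorems.AlignedTransportAtTwoDeltaPosPointLink

end
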